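import Mathlib
import Summits.Ventures.HodgeRepro.Tier4.Line1.RTFSetting
import Summits.Ventures.HodgeRepro.Tier4.Line1.RtfUnfold

/-!
# Tier4/Line1/PairOrbitalBumps — LINE L1, towards J2.c′: convolutions of bumps, bumps, parametric integrals

Blind re-derivation cell `pub-hodge-repro`, Tier 4 «prove the step» (README §9–§10), seat t4-L1-p4 (prover, gen 0;
lead S12295: t4-L1-p4 = J2.c′ `exists_pair_orbital_ne_zero`, Skeleton v0.10 3d8356354c198ec9 L531–L538 = v0.11).
LINE L1 = the relative-trace-formula line of t4-plan-1; generic layer `Tier4/Line1/RTFSetting.lean` (plan-1),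
`Tier4/Line1/RtfUnfold.lean` and `Tier4/Line1/RtfSpectralStep.lean` (t4-L1-p4, L1.2b), imported BY NAME.
Paper proof and rung cut: proofs/t4/L1/J2c.md.  THE PLAN (a repair of the skeleton's docstring plan: NO conjugate
phase extension, NO Tietze, NO approximate identity): `f₁, f₂` are non-negative bumps at `γ₀`, `1`; `f = f₁ ⋆ f₂ ≥ 0`
is a test function positive near `γ₀` and supported in a small open `V ∋ γ₀`; on `DT × DT′` only finitely many
orbit elements contribute and, by a compactness argument (`exists_open_phase_re_gt`), every contributing phase
`χ(t) conj χ′(t′)` has real part `> 1/2` once `V` is small, so `Re (orbital f) ≥ ½ ∫∫ ∑_γ f(t⁻¹γt′) > 0`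
(`orbitSum_integral_pos`: rational translates + `[Countable Gk]`).

This module (1 of 4): R1 `conv_eq_R_refl` (`f₁ ⋆ f₂ = R(f₂ˇ) f₁`), R2 `isTest_conv` (test × test is a test function),
R3 `conv_ofReal` / `convR_nonneg` / `convR_pos` (the real convolution of non-negative bumps is non-negative and
positive near `γ₀`, Haar positivity), R4 `exists_bump` (Urysohn in a locally compact regular space), R5
`exists_open_nhds_mul_subset` (`V₁ * V₂ ⊆ V`), R9 `continuous_setIntegral_orbit` (`t ↦ ∫_{DT′} c(t⁻¹γt′) w(t′)` is
continuous on `T`: uniform continuity of `c` for the right uniformity of `G`).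

Nothing here says anything about the status of the Hodge conjecture for CM abelian varieties, which is NOT proved;
HC_CM is NOT proved by anyone in this repository.
-/

set_option autoImplicit false

noncomputable section

namespace Summit.Ventures.HodgeRepro.Tier4.Line1

open MeasureTheory Topology Filter Set
open scoped Uniformity Pointwise InnerProductSpace ComplexConjugate

namespace RTF

variable {G : Type} [Group G] [TopologicalSpace G] [IsTopologicalGroup G] [MeasurableSpace G]
  [BorelSpace G]

namespace Setting

variable (S : Setting G)


/-- R1: the convolution is the right-regular action of the reflected second factor on the first:
`(f₁ ⋆ f₂)(g) = R(f₂ˇ) f₁ (g)` (left invariance of `μ`, `h = g k`). -/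
theorem conv_eq_R_refl (f₁ f₂ : G → ℂ) (g : G) : S.conv f₁ f₂ g = S.R (refl f₂) f₁ g := by
  haveI := S.haar
  unfold conv R refl
  rw [← integral_mul_left_eq_self (fun h => f₁ h * f₂ (h⁻¹ * g)) g]
  congr 1
  ext k
  simp only [mul_inv_rev, inv_mul_cancel_right]
  ring

/-- R2: the convolution of two test functions is a test function (`G` Hausdorff): continuous by
`continuous_R`, supported in the compact `tsupport f₁ * tsupport f₂`. -/
theorem isTest_conv [T2Space G] {f₁ f₂ : G → ℂ} (h₁ : IsTest f₁) (h₂ : IsTest f₂) :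
    IsTest (S.conv f₁ f₂) := by
  obtain ⟨B, hB⟩ := h₁.cont.bounded_above_of_compact_support h₁.compact
  refine ⟨?_, ?_⟩
  · have : S.conv f₁ f₂ = S.R (refl f₂) f₁ := funext fun g => S.conv_eq_R_refl f₁ f₂ g
    rw [this]
    exact S.continuous_R h₂.refl h₁.cont hB
  · refine HasCompactSupport.intro (h₁.compact.mul h₂.compact) fun x hx => ?_
    unfold conv
    have hz : ∀ h : G, f₁ h * f₂ (h⁻¹ * x) = 0 := by
      intro h
      by_contra hne
      have h1 : f₁ h ≠ 0 := fun h0 => hne (by rw [h0, zero_mul])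
      have h2 : f₂ (h⁻¹ * x) ≠ 0 := fun h0 => hne (by rw [h0, mul_zero])
      apply hx
      refine ⟨h, subset_tsupport f₁ h1, h⁻¹ * x, subset_tsupport f₂ h2, ?_⟩
      simp only [mul_inv_cancel_left]
    simp only [hz, integral_zero]

omit [IsTopologicalGroup G] [BorelSpace G] in
/-- R3a: the convolution of the complexifications of two real functions is the complexification of
their real convolution `∫ b₁(h) b₂(h⁻¹ g) dμ(h)`. -/
theorem conv_ofReal (b₁ b₂ : G → ℝ) (g : G) :
    S.conv (fun x => (b₁ x : ℂ)) (fun x => (b₂ x : ℂ)) g =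
      ((∫ h, b₁ h * b₂ (h⁻¹ * g) ∂S.μ : ℝ) : ℂ) := by
  unfold conv
  rw [← integral_complex_ofReal]
  congr 1
  ext h
  push_cast
  ring

omit [IsTopologicalGroup G] [BorelSpace G] in
/-- R3b: the real convolution of non-negative functions is non-negative. -/
theorem convR_nonneg {b₁ b₂ : G → ℝ} (h₁ : ∀ x, 0 ≤ b₁ x) (h₂ : ∀ x, 0 ≤ b₂ x) (g : G) :
    0 ≤ ∫ h, b₁ h * b₂ (h⁻¹ * g) ∂S.μ :=
  integral_nonneg fun h => mul_nonneg (h₁ h) (h₂ _)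

/-- R3c: the real convolution of non-negative continuous compactly supported functions is positive at `g`
when `b₁ g > 0` and `b₂ 1 > 0` (the integrand is positive on a non-empty open set, of positive Haar
measure). -/
theorem convR_pos {b₁ b₂ : G → ℝ} (hc₁ : Continuous b₁) (hs₁ : HasCompactSupport b₁)
    (hc₂ : Continuous b₂) (h₁ : ∀ x, 0 ≤ b₁ x) (h₂ : ∀ x, 0 ≤ b₂ x) {g : G} (hg : 0 < b₁ g)
    (h1 : 0 < b₂ 1) : 0 < ∫ h, b₁ h * b₂ (h⁻¹ * g) ∂S.μ := by
  haveI := S.haar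
  have hint : Integrable (fun h => b₁ h * b₂ (h⁻¹ * g)) S.μ := by
    have : HasCompactSupport (fun h => b₁ h * b₂ (h⁻¹ * g)) := hs₁.mul_right
    exact (hc₁.mul (hc₂.comp (continuous_inv.mul continuous_const))).integrable_of_hasCompactSupport
      this
  rw [integral_pos_iff_support_of_nonneg (fun h => mul_nonneg (h₁ h) (h₂ _)) hint]
  have hopen : IsOpen {h : G | 0 < b₁ h ∧ 0 < b₂ (h⁻¹ * g)} :=
    (isOpen_lt continuous_const hc₁).inter
      (isOpen_lt continuous_const (hc₂.comp (continuous_inv.mul continuous_const)))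
  have hne : ({h : G | 0 < b₁ h ∧ 0 < b₂ (h⁻¹ * g)}).Nonempty :=
    ⟨g, hg, by rw [inv_mul_cancel]; exact h1⟩
  have hsub : {h : G | 0 < b₁ h ∧ 0 < b₂ (h⁻¹ * g)} ⊆ Function.support fun h => b₁ h * b₂ (h⁻¹ * g) :=
    fun h hh => (mul_pos hh.1 hh.2).ne'
  exact (hopen.measure_pos S.μ hne).trans_le (measure_mono hsub)

omit [Group G] [IsTopologicalGroup G] [MeasurableSpace G] [BorelSpace G] in
/-- R4: a bump: for an open `V ∋ x₀` in a locally compact regular space there is a continuous `b : G → ℝ`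
with compact support inside `V`, `0 ≤ b ≤ 1` and `b x₀ = 1`. -/
theorem exists_bump [LocallyCompactSpace G] [RegularSpace G] {V : Set G} (hV : IsOpen V) {x₀ : G}
    (hx : x₀ ∈ V) : ∃ b : G → ℝ, Continuous b ∧ HasCompactSupport b ∧ tsupport b ⊆ V ∧
      (∀ x, 0 ≤ b x) ∧ (∀ x, b x ≤ 1) ∧ b x₀ = 1 := by
  obtain ⟨V', hV'o, hxV', hclV', -⟩ :=
    exists_open_between_and_isCompact_closure (isCompact_singleton (x := x₀)) hV
      (Set.singleton_subset_iff.mpr hx)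
  obtain ⟨f, hf1, hf0, hfc, hf01⟩ := exists_continuous_one_zero_of_isCompact
    (isCompact_singleton (x := x₀)) hV'o.isClosed_compl
    (Set.disjoint_left.mpr fun y hy hy' => hy' (by rw [Set.mem_singleton_iff.mp hy]; exact hxV' (Set.mem_singleton x₀)))
  refine ⟨f, f.continuous, hfc, ?_, fun x => (hf01 x).1, fun x => (hf01 x).2,
    hf1 (Set.mem_singleton x₀)⟩
  -- `tsupport f ⊆ closure V' ⊆ V`
  refine (closure_mono ?_).trans hclV'
  intro y hy
  by_contra hyV'
  exact hy (hf0 hyV')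

omit [MeasurableSpace G] [BorelSpace G] in
/-- R5: for an open `V ∋ γ₀` there are open `V₁ ∋ γ₀`, `V₂ ∋ 1` with `V₁ * V₂ ⊆ V`. -/
theorem exists_open_nhds_mul_subset {V : Set G} (hV : IsOpen V) {γ₀ : G} (hγ : γ₀ ∈ V) :
    ∃ V₁ V₂ : Set G, IsOpen V₁ ∧ γ₀ ∈ V₁ ∧ IsOpen V₂ ∧ (1 : G) ∈ V₂ ∧ V₁ * V₂ ⊆ V := by
  have hc : ContinuousAt (fun p : G × G => p.1 * p.2) (γ₀, 1) := continuous_mul.continuousAt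
  have hmem : (fun p : G × G => p.1 * p.2) ⁻¹' V ∈ 𝓝 (γ₀, 1) :=
    hc.preimage_mem_nhds (by rw [mul_one]; exact hV.mem_nhds hγ)
  rw [mem_nhds_prod_iff] at hmem
  obtain ⟨u, hu, v, hv, huv⟩ := hmem
  obtain ⟨V₁, hV₁u, hV₁o, hγV₁⟩ := mem_nhds_iff.mp hu
  obtain ⟨V₂, hV₂v, hV₂o, h1V₂⟩ := mem_nhds_iff.mp hv
  refine ⟨V₁, V₂, hV₁o, hγV₁, hV₂o, h1V₂, ?_⟩
  rintro x ⟨a, ha, b, hb, rfl⟩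
  exact huv (Set.mk_mem_prod (hV₁u ha) (hV₂v hb))

/-- R9 (the parametric-integral continuity, along the tori): for a test function `c` on `G`, a fixed
`γ ∈ G` and an integrable weight `w` on `DT'`, the function `t ↦ ∫_{DT'} c(t⁻¹ γ t') w(t')` is
continuous on `T` (uniform continuity of `c` for the right uniformity: `(t⁻¹γt') (t₀⁻¹γt')⁻¹ = t⁻¹ t₀`). -/
theorem continuous_setIntegral_orbit {c : G → ℂ} (hc : IsTest c) (γ : G) {w : S.T' → ℂ}
    (hw : IntegrableOn w S.DT' S.μT') :
    Continuous fun t : S.T => ∫ t' in S.DT', c ((t : G)⁻¹ * γ * t') * w t' ∂S.μT' := by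
  letI : UniformSpace G := IsTopologicalGroup.rightUniformSpace G
  have huc : UniformContinuous c := hc.compact.uniformContinuous_of_continuous hc.cont
  rw [continuous_iff_continuousAt]
  intro t₀
  rw [ContinuousAt, Metric.tendsto_nhds]
  intro ε hε
  set I : ℝ := ∫ t' in S.DT', ‖w t'‖ ∂S.μT' with hI
  have hI0 : 0 ≤ I := integral_nonneg fun _ => norm_nonneg _
  set δ : ℝ := ε / (2 * (I + 1)) with hδ
  have hδpos : 0 < δ := by positivity
  have hent : {p : G × G | dist (c p.1) (c p.2) < δ} ∈ 𝓤 G :=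
    huc (Metric.dist_mem_uniformity hδpos)
  rw [uniformity_eq_comap_nhds_one' G, Filter.mem_comap] at hent
  obtain ⟨U, hU, hUsub⟩ := hent
  have hV : {t : S.T | (t : G)⁻¹ * t₀ ∈ U} ∈ 𝓝 t₀ := by
    have hcont : Continuous fun t : S.T => (t : G)⁻¹ * (t₀ : G) :=
      (continuous_subtype_val.inv).mul continuous_const
    exact hcont.continuousAt.preimage_mem_nhds (by rw [inv_mul_cancel]; exact hU)
  filter_upwards [hV] with t ht
  have hdiff : ∀ t' : S.T', ‖c ((t : G)⁻¹ * γ * t') - c ((t₀ : G)⁻¹ * γ * t')‖ ≤ δ := by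
    intro t'
    have hmem : ((t₀ : G)⁻¹ * γ * t', (t : G)⁻¹ * γ * t') ∈
        (fun p : G × G => p.2 * p.1⁻¹) ⁻¹' U := by
      simp only [Set.mem_preimage, mul_inv_rev, inv_inv]
      convert ht using 1
      group
    have := hUsub hmem
    simp only [Set.mem_setOf_eq, dist_eq_norm] at this
    rw [norm_sub_rev]
    exact this.le
  have hi : ∀ s : S.T, IntegrableOn (fun t' : S.T' => c ((s : G)⁻¹ * γ * t') * w t') S.DT' S.μT' := by
    intro s
    obtain ⟨C, hC⟩ := hc.cont.bounded_above_of_compact_support hc.compact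
    refine Integrable.bdd_mul hw ?_ (Eventually.of_forall fun t' => hC _)
    exact (hc.cont.comp (continuous_const.mul continuous_subtype_val)).aestronglyMeasurable
  rw [dist_eq_norm, ← integral_sub (hi t) (hi t₀)]
  calc ‖∫ t' in S.DT', (c ((t : G)⁻¹ * γ * t') * w t' - c ((t₀ : G)⁻¹ * γ * t') * w t') ∂S.μT'‖
      ≤ ∫ t' in S.DT', ‖c ((t : G)⁻¹ * γ * t') * w t' - c ((t₀ : G)⁻¹ * γ * t') * w t'‖ ∂S.μT' :=
        norm_integral_le_integral_norm _
    _ ≤ ∫ t' in S.DT', δ * ‖w t'‖ ∂S.μT' := by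
        apply integral_mono_of_nonneg (Eventually.of_forall fun _ => norm_nonneg _)
          (hw.norm.const_mul δ)
        refine Eventually.of_forall fun t' => ?_
        show ‖c ((t : G)⁻¹ * γ * t') * w t' - c ((t₀ : G)⁻¹ * γ * t') * w t'‖ ≤ δ * ‖w t'‖
        rw [← sub_mul, norm_mul]
        exact mul_le_mul_of_nonneg_right (hdiff t') (norm_nonneg _)
    _ = δ * I := by rw [integral_const_mul]
    _ < ε := by
        rw [hδ]
        have : ε / (2 * (I + 1)) * I < ε / (2 * (I + 1)) * (2 * (I + 1)) :=
          mul_lt_mul_of_pos_left (by linarith) (by positivity)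
        rw [div_mul_cancel₀ _ (by positivity)] at this
        exact this

end Setting

end RTF

end Summit.Ventures.HodgeRepro.Tier4.Line1
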